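import Literature.Analysis.Complex.PQFlatPoincare
import HarnessLib

/-!
# `∂̄`-exhaustion of a polydisc for `(p,q+2)`-forms (Hörmander, proof of Thm. 2.7.8, case `q ≥ 1`)

From the `∂̄`-Poincaré lemma with shrinking (`exists_dbar_potential_of_type`: a potential on
every smaller polydisc) to a potential on the WHOLE polydisc, for data of type `(p,q+2)`:

* `dbar_dbar_eq_zero` — the flat identity `∂̄(∂̄γ) = 0`, i.e.
  `(d (dγ)^{p,q+1})^{p,q+2} = 0` for `C^∞` forms `γ` of pure type `(p,q)` on `ℂ^ι`
  (coordinates: `∑_{k,j} dz̄_k ∧ dz̄_j ∧ ∂̄_k ∂̄_j γ = 0` by symmetry of second derivatives);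
* `exists_dbar_potential_on_exhaustion` — **Theorem.** for an increasing union `U = ⋃_m D(c, ρ_m)`
  of concentric polydiscs and `α : ℂ^ι → Λ^{n+1}`, `C^∞` on `U`, of type `(p,q+2)` on `U` with
  `(dα)^{p,q+3} = 0` on `U`, there is `β : ℂ^ι → Λ^n`, `C^∞` on `U`, fixed by the
  `(p,q+1)`-projection, with `(dβ)^{p,q+2} = α` on all of `U`; corollaries
  `exists_dbar_potential_on_polydisc` (`U = D(c,r)`) and `exists_dbar_potential_on_univ`
  (`U = ℂ^ι`).

The proof is Hörmander's (1973, proof of Thm. 2.7.8, the case `q > 0`, p. 59, there for general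
pseudoconvex domains via Thm. 2.7.6; here the elementary polydisc case): exhaust `D` by
`D_m = D(c, r - 1/(m+1))`, take potentials `β_m` on `D_m` from Thm. 2.3.3, and correct
`β_{m+1}` by `∂̄γ_m` where `∂̄γ_m = β_{m+1} - β̃_m` on `D_{m-1}` (Thm. 2.3.3 one bidegree down —
available because the potentials have `q+1 ≥ 1`), so that the corrected sequence is eventually
constant on every `D_m`; its eventual value is the potential. (For data of type `(p,1)` the
corrections are holomorphic and one needs polynomial approximation instead — not treated here.)

## References

* L. Hörmander, *An Introduction to Complex Analysis in Several Variables*, 2nd ed. (1973),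
  Thm. 2.3.3 and proof of Thm. 2.7.8. [HormanderSCV1973]
-/

noncomputable section

open scoped ComplexConjugate ContDiff Topology
open Complex Function ContinuousAlternatingMap Set Filter Metric
open Literature.LinearAlgebra.Alternating

namespace Literature.Analysis.Complex

variable {ι : Type*} [Fintype ι] [DecidableEq ι]

/-! ### `∂̄ ∘ ∂̄ = 0` on flat forms of pure type -/

/-- The coordinate `∂̄` of a form of type `(p,q)` has type `(p,q+1)`. [cite: HormanderSCV1973, §2.1] -/
theorem isOfTypeAt_sum_wedgeOne_dbarAlong {n p q : ℕ} {γ : (ι → ℂ) → (ι → ℂ) [⋀^Fin n]→L[ℝ] ℂ}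
    (hγ : ∀ y, IsOfTypeAt p q (γ y)) (x : ι → ℂ) :
    IsOfTypeAt p (q + 1) (∑ j, wedgeOne (dzBar j) (dbarAlong (Pi.single j 1) γ x)) := by
  have hn : p + (q + 1) = n + 1 := by have := (hγ x).1; omega
  refine Finset.sum_induction _ (IsOfTypeAt p (q + 1)) (fun a b ha hb => ha.add hb)
    (isOfTypeAt_zero hn) fun j _ => ?_
  by_cases hd : DifferentiableAt ℝ γ x
  · exact (IsOfTypeAt.dbarAlong hγ hd _).wedgeOne_of_conj fun c w => by
      rw [dzBar_apply, dzBar_apply, Pi.smul_apply, smul_eq_mul, map_mul]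
  · rw [dbarAlong_eq_zero_of_not_differentiableAt hd, wedgeOne_zero]
    exact isOfTypeAt_zero hn

/-- **`∂̄ ∘ ∂̄ = 0`** on `C^∞` forms of pure type `(p,q)` on `ℂ^ι`:
`(d (dγ)^{p,q+1})^{p,q+2} = 0`; in coordinates `∑_{k,j} dz̄_k ∧ dz̄_j ∧ ∂̄_k ∂̄_j γ = 0` by the
symmetry of second derivatives and the anticommutativity of `dz̄_k ∧ dz̄_j ∧ ·`
(Hörmander (1973), §2.1, `∂̄² = 0`). [cite: HormanderSCV1973, §2.1] -/
theorem dbar_dbar_eq_zero {n p q : ℕ} {γ : (ι → ℂ) → (ι → ℂ) [⋀^Fin n]→L[ℝ] ℂ}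
    (hγt : ∀ y, IsOfTypeAt p q (γ y)) (hγ : ContDiff ℝ ∞ γ) (x : ι → ℂ) :
    typeProjAt p (q + 2) (extDeriv (fun y => typeProjAt p (q + 1) (extDeriv γ y)) x) = 0 := by
  have h1 : (fun y => typeProjAt p (q + 1) (extDeriv γ y)) =
      fun y => ∑ j, wedgeOne (dzBar j) (dbarAlong (Pi.single j 1) γ y) :=
    funext fun y => typeProjAt_extDeriv_eq_sum hγt y
  rw [h1, typeProjAt_extDeriv_eq_sum (isOfTypeAt_sum_wedgeOne_dbarAlong hγt)]
  -- differentiability of the first derivatives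
  have hdj : ∀ j, ContDiff ℝ ∞ (dbarAlong (Pi.single j (1 : ℂ)) γ) := fun j =>
    contDiff_infty_dbarAlong hγ _
  have hdjx : ∀ j, DifferentiableAt ℝ (dbarAlong (Pi.single j (1 : ℂ)) γ) x := fun j =>
    ((hdj j).differentiable (by simp)).differentiableAt
  have hwj : ∀ j, DifferentiableAt ℝ
      (fun y => wedgeOne (dzBar j) (dbarAlong (Pi.single j (1 : ℂ)) γ y)) x := fun j =>
    (((wedgeOneL (F := ℂ) (dzBar j)).restrictScalars ℝ).differentiableAt).comp x (hdjx j)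
  -- expand `∂̄_k` of the sum
  have h2 : ∀ k, dbarAlong (Pi.single k 1)
      (fun y => ∑ j, wedgeOne (dzBar j) (dbarAlong (Pi.single j 1) γ y)) x =
      ∑ j, wedgeOne (dzBar j) (dbarAlong (Pi.single k 1) (dbarAlong (Pi.single j 1) γ) x) := by
    intro k
    rw [dbarAlong_finset_sum _ (fun j _ => hwj j)]
    refine Finset.sum_congr rfl fun j _ => ?_
    exact dbarAlong_clm_comp (wedgeOneL (dzBar j)) (hdjx j) _
  simp_rw [h2]
  simp only [← wedgeOneL_apply, _root_.map_sum]
  simp only [wedgeOneL_apply]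
  -- the double sum is antisymmetric under `(k, j) ↦ (j, k)`
  set A : ι → ι → (ι → ℂ) [⋀^Fin (n + 1 + 1)]→L[ℝ] ℂ := fun k j =>
    wedgeOne (dzBar k) (wedgeOne (dzBar j) (dbarAlong (Pi.single k 1) (dbarAlong (Pi.single j 1) γ) x))
  have hA : ∀ k j, A k j = -A j k := by
    intro k j
    simp only [A]
    have h2 : (2 : WithTop ℕ∞) ≤ ∞ := by norm_cast
    rw [dbarAlong_comm (hγ.contDiffAt (x := x)) h2 (Pi.single k 1) (Pi.single j 1)]
    exact eq_neg_of_add_eq_zero_left (wedgeOne_wedgeOne_add_swap (dzBar k) (dzBar j) _)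
  have hS : ∑ k, ∑ j, A k j = -∑ k, ∑ j, A k j := by
    conv_rhs => rw [Finset.sum_comm]
    rw [← Finset.sum_neg_distrib]
    refine Finset.sum_congr rfl fun k _ => ?_
    rw [← Finset.sum_neg_distrib]
    exact Finset.sum_congr rfl fun j _ => hA k j
  have h2S : (∑ k, ∑ j, A k j) + ∑ k, ∑ j, A k j = 0 := by
    nth_rewrite 2 [hS]
    exact add_neg_cancel _
  rw [← two_smul ℝ] at h2S
  exact (smul_eq_zero.mp h2S).resolve_left two_ne_zero

/-! ### Exhaustion of a polydisc -/

omit [DecidableEq ι] in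
/-- Every point of a polydisc lies in one of the shrunken polydiscs `D(c, r - 1/(m+1))`.
[folklore] -/
theorem exists_mem_polydisc_sub (c : ι → ℂ) (r : ι → ℝ) {x : ι → ℂ} (hx : x ∈ polydisc c r) :
    ∃ m : ℕ, x ∈ polydisc c fun i => r i - 1 / ((m : ℝ) + 1) := by
  have h : ∀ i, ∀ᶠ m : ℕ in atTop, x i ∈ ball (c i) (r i - 1 / ((m : ℝ) + 1)) := by
    intro i
    have hi : dist (x i) (c i) < r i := mem_ball.1 (mem_polydisc.1 hx i)
    have ht : Tendsto (fun m : ℕ => 1 / ((m : ℝ) + 1)) atTop (𝓝 0) :=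
      tendsto_one_div_add_atTop_nhds_zero_nat
    filter_upwards [ht.eventually (gt_mem_nhds (sub_pos.2 hi))] with m hm
    exact mem_ball.2 (by linarith)
  obtain ⟨m, hm⟩ := (eventually_all.2 h).exists
  exact ⟨m, mem_polydisc.2 hm⟩

omit [DecidableEq ι] in
/-- The type projection of a difference. [folklore] -/
theorem typeProjAt_sub {k : ℕ} (p q : ℕ) (η η' : (ι → ℂ) [⋀^Fin k]→L[ℝ] ℂ) :
    typeProjAt p q (η - η') = typeProjAt p q η - typeProjAt p q η' :=
  map_sub (typeProjₗ (E := ι → ℂ) (k := k) p q) η η'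

omit [DecidableEq ι] in
/-- The exterior derivative of a difference of differentiable forms. [folklore] -/
theorem extDeriv_sub_apply {k : ℕ} {ω₁ ω₂ : (ι → ℂ) → (ι → ℂ) [⋀^Fin k]→L[ℝ] ℂ} {x : ι → ℂ}
    (h₁ : DifferentiableAt ℝ ω₁ x) (h₂ : DifferentiableAt ℝ ω₂ x) :
    extDeriv (fun y => ω₁ y - ω₂ y) x = extDeriv ω₁ x - extDeriv ω₂ x := by
  simp only [extDeriv, ← alternatizeUncurryFinCLM_apply]
  rw [fderiv_fun_sub h₁ h₂, map_sub]

omit [DecidableEq ι] in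
/-- `x ↦ (dγ(x))^{p,q}` is `C^∞` for a `C^∞` form `γ`. [folklore] -/
theorem contDiff_typeProjAt_extDeriv {k : ℕ} (p q : ℕ) {γ : (ι → ℂ) → (ι → ℂ) [⋀^Fin k]→L[ℝ] ℂ}
    (hγ : ContDiff ℝ ∞ γ) : ContDiff ℝ ∞ fun x => typeProjAt p q (extDeriv γ x) := by
  have h1 : ContDiff ℝ ∞ (fderiv ℝ γ) := (contDiff_infty_iff_fderiv.1 hγ).2
  have h2 : ContDiff ℝ ∞ (extDeriv γ) := by
    have : extDeriv γ = fun x => alternatizeUncurryFinCLM ℝ (ι → ℂ) ℂ (fderiv ℝ γ x) := by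
      funext x; simp [extDeriv]
    rw [this]
    exact (alternatizeUncurryFinCLM ℝ (ι → ℂ) ℂ).contDiff.comp h1
  exact ((typeProjL (E := ι → ℂ) (k := k + 1) p q).restrictScalars ℝ).contDiff.comp h2

/-- **`∂̄`-potentials on an exhaustion by concentric polydiscs, data of type `(p,q+2)`**
(Hörmander (1973), Thm. 2.7.8, case `q+1 ≥ 1` of the potential, for unions of increasing
polydiscs): let `D_m = D(c, ρ_m)` be polydiscs with `ρ_m i < ρ_{m+1} i`, `U = ⋃_m D_m`, and
`α : ℂ^ι → Λ^{n+1}` be `C^∞` on `U`, of pointwise type `(p,q+2)` on `U` with `(dα)^{p,q+3} = 0` on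
`U`. Then there is `β : ℂ^ι → Λ^n`, `C^∞` on `U`, fixed by the `(p,q+1)`-projection, with
`(dβ)^{p,q+2} = α` on `U`. Proof: potentials `B_m` on `D_m` (`exists_dbar_potential_of_type` on
`D_{m+1} ⊇ D_m`) corrected successively by `∂̄`-exact terms (`dbar_dbar_eq_zero`) so that the
sequence is eventually constant on each `D_m`. [cite: HormanderSCV1973, Thm. 2.7.8] -/
theorem exists_dbar_potential_on_exhaustion {n p q : ℕ} {c : ι → ℂ} {ρ : ℕ → ι → ℝ}
    (hρm : ∀ m i, ρ m i < ρ (m + 1) i)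
    {α : (ι → ℂ) → (ι → ℂ) [⋀^Fin (n + 1)]→L[ℝ] ℂ} (hα : ContDiffOn ℝ ∞ α (⋃ m, polydisc c (ρ m)))
    (htype : ∀ x ∈ ⋃ m, polydisc c (ρ m), IsOfTypeAt p (q + 2) (α x))
    (hclosed : ∀ x ∈ ⋃ m, polydisc c (ρ m), typeProjAt p (q + 3) (extDeriv α x) = 0) :
    ∃ β : (ι → ℂ) → (ι → ℂ) [⋀^Fin n]→L[ℝ] ℂ, ContDiffOn ℝ ∞ β (⋃ m, polydisc c (ρ m)) ∧
      (∀ x, typeProjAt p (q + 1) (β x) = β x) ∧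
      ∀ x ∈ ⋃ m, polydisc c (ρ m), typeProjAt p (q + 2) (extDeriv β x) = α x := by
  cases n with
  | zero =>
    -- no nonzero `1`-forms of type `(p,q+2)`: `U = ∅` or the hypotheses are contradictory
    refine ⟨0, contDiffOn_const, fun x => by simp, fun x hx => ?_⟩
    have := (htype x hx).1
    omega
  | succ n =>
  have hρle : ∀ {m m' : ℕ}, m ≤ m' → ∀ i, ρ m i ≤ ρ m' i := by
    intro m m' h i
    induction h with
    | refl => exact le_rfl
    | step _ ih => exact ih.trans (hρm _ i).le
  have hDU : ∀ m, polydisc c (ρ m) ⊆ ⋃ m, polydisc c (ρ m) := fun m =>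
    subset_iUnion (fun m => polydisc c (ρ m)) m
  -- potentials on the `D_m` (Thm. 2.3.3 on `D_{m+1} ⊇ D_m`)
  have hex : ∀ m, ∃ β : (ι → ℂ) → (ι → ℂ) [⋀^Fin (n + 1)]→L[ℝ] ℂ, ContDiff ℝ ∞ β ∧
      (∀ x, typeProjAt p (q + 1) (β x) = β x) ∧
      ∀ x ∈ polydisc c (ρ m), typeProjAt p (q + 2) (extDeriv β x) = α x := fun m =>
    exists_dbar_potential_of_type (hρm m) (hα.mono (hDU (m + 1)))
      (fun x hx => htype x (hDU (m + 1) hx)) (fun x hx => hclosed x (hDU (m + 1) hx))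
  choose B hB₁ hB₂ hB₃ using hex
  -- the invariant of the corrected sequence and the correction step (Thm. 2.3.3 one level down)
  let Inv : ℕ → ((ι → ℂ) → (ι → ℂ) [⋀^Fin (n + 1)]→L[ℝ] ℂ) → Prop := fun m β =>
    ContDiff ℝ ∞ β ∧ (∀ x, typeProjAt p (q + 1) (β x) = β x) ∧
      ∀ x ∈ polydisc c (ρ (m + 1)), typeProjAt p (q + 2) (extDeriv β x) = α x
  have corr : ∀ m β, Inv m β → ∃ β', Inv (m + 1) β' ∧ ∀ x ∈ polydisc c (ρ m), β' x = β x := by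
    rintro m β ⟨hβ₁, hβ₂, hβ₃⟩
    by_cases hne : (polydisc c (ρ (m + 1))).Nonempty
    swap
    · -- empty `D_{m+1}`: restart from `B (m+2)`
      refine ⟨B (m + 2), ⟨hB₁ _, hB₂ _, hB₃ _⟩, fun x hx => ?_⟩
      exact absurd ⟨x, polydisc_mono c (fun i => (hρm m i).le) hx⟩ hne
    obtain ⟨x₀, hx₀⟩ := hne
    have hpq : p + (q + 2) = n + 1 + 1 := (htype x₀ (hDU (m + 1) hx₀)).1
    -- `δ = B (m+2) - β` is smooth, of type `(p,q+1)`, `∂̄`-closed on `D_{m+1}`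
    set δ : (ι → ℂ) → (ι → ℂ) [⋀^Fin (n + 1)]→L[ℝ] ℂ := fun x => B (m + 2) x - β x with hδ
    have hδs : ContDiff ℝ ∞ δ := (hB₁ (m + 2)).sub hβ₁
    have hδt : ∀ x, IsOfTypeAt p (q + 1) (δ x) := fun x =>
      (isOfTypeAt_iff_typeProjAt_eq_self (by omega) _).2
        (by simp only [hδ, typeProjAt_sub, hB₂, hβ₂])
    have hδc : ∀ x ∈ polydisc c (ρ (m + 1)), typeProjAt p (q + 2) (extDeriv δ x) = 0 := by
      intro x hx
      rw [hδ, extDeriv_sub_apply (((hB₁ (m + 2)).differentiable (by simp)).differentiableAt)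
        ((hβ₁.differentiable (by simp)).differentiableAt),
        typeProjAt_sub, hB₃ (m + 2) x (polydisc_mono c (fun i => (hρm (m + 1) i).le) hx),
        hβ₃ x hx, sub_self]
    obtain ⟨γ, hγ₁, hγ₂, hγ₃⟩ :=
      exists_dbar_potential_of_type (hρm m) hδs.contDiffOn (fun x _ => hδt x) hδc
    have hγt : ∀ y, IsOfTypeAt p q (γ y) := fun y =>
      (isOfTypeAt_iff_typeProjAt_eq_self (by omega) _).2 (hγ₂ y)
    refine ⟨fun x => B (m + 2) x - typeProjAt p (q + 1) (extDeriv γ x), ⟨?_, ?_, ?_⟩, ?_⟩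
    · exact (hB₁ (m + 2)).sub (contDiff_typeProjAt_extDeriv p (q + 1) hγ₁)
    · intro x
      simp only [typeProjAt_sub, hB₂, typeProjAt_typeProjAt_self]
    · intro x hx
      rw [extDeriv_sub_apply (((hB₁ (m + 2)).differentiable (by simp)).differentiableAt)
        (((contDiff_typeProjAt_extDeriv p (q + 1) hγ₁).differentiable (by simp)).differentiableAt),
        typeProjAt_sub, hB₃ (m + 2) x hx, dbar_dbar_eq_zero hγt hγ₁ x, sub_zero]
    · intro x hx
      simp only [hγ₃ x hx, hδ, sub_sub_cancel]
  -- the corrected sequence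
  have inv0 : Inv 0 (B 1) := ⟨hB₁ 1, hB₂ 1, hB₃ 1⟩
  let S : ∀ m : ℕ, {β // Inv m β} := fun m =>
    Nat.rec (motive := fun m => {β // Inv m β}) ⟨B 1, inv0⟩
      (fun m s => ⟨Classical.choose (corr m s.1 s.2), (Classical.choose_spec (corr m s.1 s.2)).1⟩) m
  have hS : ∀ m, ∀ x ∈ polydisc c (ρ m), (S (m + 1)).1 x = (S m).1 x := fun m =>
    (Classical.choose_spec (corr m (S m).1 (S m).2)).2
  have hS' : ∀ m j, ∀ x ∈ polydisc c (ρ m), (S (m + j)).1 x = (S m).1 x := by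
    intro m j x hx
    induction j with
    | zero => rfl
    | succ j ih =>
      rw [← ih, ← add_assoc]
      exact hS (m + j) x (polydisc_mono c (hρle (Nat.le_add_right m j)) hx)
  -- its eventual value
  classical
  let β : (ι → ℂ) → (ι → ℂ) [⋀^Fin (n + 1)]→L[ℝ] ℂ := fun x =>
    if h : ∃ m, x ∈ polydisc c (ρ m) then (S (Nat.find h)).1 x else 0
  have hβS : ∀ m, ∀ x ∈ polydisc c (ρ m), β x = (S m).1 x := by
    intro m x hx
    have h : ∃ m, x ∈ polydisc c (ρ m) := ⟨m, hx⟩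
    simp only [β, dif_pos h]
    have hk : Nat.find h ≤ m := Nat.find_min' h hx
    obtain ⟨j, rfl⟩ := Nat.exists_eq_add_of_le hk
    exact (hS' _ j x (Nat.find_spec h)).symm
  have hβev : ∀ m, ∀ x ∈ polydisc c (ρ m), β =ᶠ[𝓝 x] (S m).1 := fun m x hx =>
    Filter.eventuallyEq_of_mem ((isOpen_polydisc c (ρ m)).mem_nhds hx) (hβS m)
  refine ⟨β, fun x hx => ?_, fun x => ?_, fun x hx => ?_⟩
  · obtain ⟨m, hm⟩ := mem_iUnion.1 hx
    exact (((S m).2.1.contDiffAt).congr_of_eventuallyEq (hβev m x hm)).contDiffWithinAt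
  · simp only [β]
    split_ifs with h
    · exact (S (Nat.find h)).2.2.1 x
    · exact typeProjAt_zero p (q + 1)
  · obtain ⟨m, hm⟩ := mem_iUnion.1 hx
    rw [extDeriv_congr_of_eventuallyEq (hβev m x hm)]
    exact (S m).2.2.2 x (polydisc_mono c (fun i => (hρm m i).le) hm)

/-! ### Polydiscs and the whole space -/

omit [DecidableEq ι] in
/-- The standard exhaustion of a polydisc: `D(c, r) = ⋃_m D(c, r - 1/(m+1))`. [folklore] -/
theorem iUnion_polydisc_sub (c : ι → ℂ) (r : ι → ℝ) :
    (⋃ m : ℕ, polydisc c fun i => r i - 1 / ((m : ℝ) + 1)) = polydisc c r := by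
  refine Subset.antisymm (iUnion_subset fun m => polydisc_mono c fun i => ?_) fun x hx => ?_
  · have : (0 : ℝ) < 1 / ((m : ℝ) + 1) := by positivity
    linarith
  · exact mem_iUnion.2 (exists_mem_polydisc_sub c r hx)

omit [Fintype ι] [DecidableEq ι] in
/-- The radii `r - 1/(m+1)` increase with `m`. [folklore] -/
theorem sub_one_div_lt_succ (r : ι → ℝ) (m : ℕ) (i : ι) :
    r i - 1 / ((m : ℝ) + 1) < r i - 1 / (((m + 1 : ℕ) : ℝ) + 1) := by
  have : (1 : ℝ) / ((((m + 1 : ℕ)) : ℝ) + 1) < 1 / ((m : ℝ) + 1) := by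
    apply one_div_lt_one_div_of_lt (by positivity)
    push_cast
    linarith
  linarith

omit [DecidableEq ι] in
/-- The standard exhaustion of `ℂ^ι`: `ℂ^ι = ⋃_m D(c, m+1)`. [folklore] -/
theorem iUnion_polydisc_nat (c : ι → ℂ) :
    (⋃ m : ℕ, polydisc c fun _ => (m : ℝ) + 1) = univ := by
  refine eq_univ_of_forall fun x => mem_iUnion.2 ?_
  obtain ⟨m, hm⟩ := exists_nat_gt ‖x - c‖
  refine ⟨m, mem_polydisc.2 fun i => mem_ball.2 ?_⟩
  rw [dist_eq_norm]
  calc ‖x i - c i‖ = ‖(x - c) i‖ := rfl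
    _ ≤ ‖x - c‖ := norm_le_pi_norm (x - c) i
    _ < m := hm
    _ < (m : ℝ) + 1 := lt_add_one _

/-- **`∂̄`-potentials on a whole polydisc for data of type `(p,q+2)`** (Hörmander (1973),
Thm. 2.7.8 for polydiscs, case `q+1 ≥ 1` of the potential): if `α : ℂ^ι → Λ^{n+1}` is `C^∞` on
`D = D(c,r)`, of pointwise type `(p,q+2)` on `D` and `(dα)^{p,q+3} = 0` on `D`, then there is
`β : ℂ^ι → Λ^n`, `C^∞` on `D`, fixed by the `(p,q+1)`-projection, with `(dβ)^{p,q+2} = α` on `D`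
(the exhaustion `D = ⋃_m D(c, r - 1/(m+1))`). [cite: HormanderSCV1973, Thm. 2.7.8] -/
theorem exists_dbar_potential_on_polydisc {n p q : ℕ} {c : ι → ℂ} {r : ι → ℝ}
    {α : (ι → ℂ) → (ι → ℂ) [⋀^Fin (n + 1)]→L[ℝ] ℂ} (hα : ContDiffOn ℝ ∞ α (polydisc c r))
    (htype : ∀ x ∈ polydisc c r, IsOfTypeAt p (q + 2) (α x))
    (hclosed : ∀ x ∈ polydisc c r, typeProjAt p (q + 3) (extDeriv α x) = 0) :
    ∃ β : (ι → ℂ) → (ι → ℂ) [⋀^Fin n]→L[ℝ] ℂ, ContDiffOn ℝ ∞ β (polydisc c r) ∧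
      (∀ x, typeProjAt p (q + 1) (β x) = β x) ∧
      ∀ x ∈ polydisc c r, typeProjAt p (q + 2) (extDeriv β x) = α x := by
  rw [← iUnion_polydisc_sub c r] at hα htype hclosed ⊢
  exact exists_dbar_potential_on_exhaustion (sub_one_div_lt_succ r) hα htype hclosed

/-- **`∂̄`-potentials on all of `ℂ^ι` for data of type `(p,q+2)`** (Hörmander (1973), Thm. 2.7.8
for `Ω = ℂⁿ`, case `q+1 ≥ 1`): a `C^∞` form `α : ℂ^ι → Λ^{n+1}` of type `(p,q+2)` with
`(dα)^{p,q+3} = 0` is `(dβ)^{p,q+2}` for a `C^∞` form `β` fixed by the `(p,q+1)`-projection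
(the exhaustion `ℂ^ι = ⋃_m D(0, m+1)`). [cite: HormanderSCV1973, Thm. 2.7.8] -/
theorem exists_dbar_potential_on_univ {n p q : ℕ}
    {α : (ι → ℂ) → (ι → ℂ) [⋀^Fin (n + 1)]→L[ℝ] ℂ} (hα : ContDiff ℝ ∞ α)
    (htype : ∀ x, IsOfTypeAt p (q + 2) (α x))
    (hclosed : ∀ x, typeProjAt p (q + 3) (extDeriv α x) = 0) :
    ∃ β : (ι → ℂ) → (ι → ℂ) [⋀^Fin n]→L[ℝ] ℂ, ContDiff ℝ ∞ β ∧
      (∀ x, typeProjAt p (q + 1) (β x) = β x) ∧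
      ∀ x, typeProjAt p (q + 2) (extDeriv β x) = α x := by
  have hU := iUnion_polydisc_nat (ι := ι) (0 : ι → ℂ)
  obtain ⟨β, hβ, hβf, hβα⟩ := exists_dbar_potential_on_exhaustion (c := (0 : ι → ℂ))
    (ρ := fun m _ => (m : ℝ) + 1) (p := p) (q := q) (fun m i => by push_cast; linarith)
    (by rw [hU]; exact hα.contDiffOn) (fun x _ => htype x) (fun x _ => hclosed x)
  rw [hU] at hβ hβα
  exact ⟨β, contDiffOn_univ.1 hβ, hβf, fun x => hβα x (mem_univ x)⟩

end Literature.Analysis.Complex
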